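import Summits.BirchSwinnertonDyer.Rank1Residual.X11b.BDPRouteAssembly
import Summits.BirchSwinnertonDyer.Rank1Residual.X11b.TwistTransportRam
import Summits.BirchSwinnertonDyer.Rank1Residual.X11b.TwistTransportUnit
import Literature.NumberTheory.EllipticCurves.BSDSelmerPConverse
import Literature.NumberTheory.EllipticCurves.RootNumberEvenAnalyticRankProofs
import Literature.NumberTheory.DiophantineGeometry.AbcWave0GranvilleStarkTheorem2Proofs
import HarnessLib

/-!
# Class X11b, route "BDP + converse-theorem engine + Kolyvagin": the sub-cell target from the typed input and two transport packages (cell `b2b-bsdres`, sub-cell `multr1-p2`)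

HONEST FRAMING (cell `b2b-bsdres`, run/shared/lean/b2b/bsd-rank1-residual/, verbatim in every
file): the goal of the cell is to DELETE the COMBINATION-SHAPED residual classes of the
Birch–Swinnerton-Dyer formula for ALL analytic-rank `≤ 1` elliptic curves over `ℚ` — "full BSD
formula for every rank `≤ 1` curve in class `C`" assembled STRICTLY from published theorems — so
that the rank-`≤ 1` remainder becomes exactly the CONSTRUCTION-SHAPED classes, which are TYPED
(missing-input `Prop`s), NOT attempted. This is not "finishing BSD". Sub-cell `multr1-p2` is a
RESEARCH ROUTE on class X11b; no claim beyond the stated class and locus; X11b's label does not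
change.

THEOREMS ONLY (no definition, no new named fact). `bsdp_of_classX11b_of_locus_of_transport`: the
sub-cell target (`∀` pairs of X11b on the `Locus` ⇒ `BSDp`; = `X11b.Statement` of `X11b/BDPRoute.lean`,
appended there as p200200) follows from
* the route's ONE typed input, STEP L, at every Heegner datum of every pair on the locus
  (`IndexLowerBoundAt`; OPEN at `p ∥ N`, see `X11b/BDPRoute.lean`);
* PUBLISHED named facts of the tree, as binders: Gross–Zagier (`gross_zagier`), Kolyvagin 1990
  Thm. A (`kolyvagin`, `Kolyvagin1990_padicValNat_card_sha_le`), Skinner 2016 Thm. C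
  (`Skinner2016.thmC_padicValRat_bsd_rank_zero`), Gross–Zagier–Kolyvagin over `ℚ`
  (`rank_eq_analyticRank_of_analyticRank_le_one`), modularity (`hasEntireLFunction_rat`,
  `ModularForms.exists_isNewformOf` — for `w(E) = (−1)^{r_an}`), and the auxiliary-field theorem of
  Bump–Friedberg–Hoffstein / Murty–Murty / Friedberg–Hoffstein
  (`friedbergHoffstein_exists_heegnerField_split_twist_ne_zero`: `K` with every `ℓ ∣ N` split,
  `|d_K|` large, `L(E^{d_K},1) ≠ 0`); `w_K = 2` for `d_K < −4` is the tree theorem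
  `DiophantineGeometry.torsionOrder_eq_two_of_discr_lt`;
* TWO TRANSPORT PACKAGES, stated inline as hypotheses (each a routine published fact NOT yet a tree
  theorem; listed as (a)–(f) in HOME/b2b-bsdres-multr1-p2/REPORT.md §5): `hMan` — at a prime
  `p ≥ 5` of multiplicative reduction with `E[p]` irreducible, a Heegner point of a parametrisation
  datum whose Manin constant is prime to `p` (Gross 1984 / Gross–Zagier 1986 I.§4 for the point —
  tree fact `exists_isHeegnerPoint` gives SOME datum —; Mazur 1978 Cor. 4.1 / Abbes–Ullmo 1996 Thm. A
  for the Manin constant of the optimal curve at `p ∥ N`, transported along an isogeny of degree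
  prime to `p`); `hTw` — for `K` with every `ℓ ∣ N` split, EVERY globally minimal model `Wd = Cd • W^{(d_K)}`
  of the twist has `Wd[p]` irreducible (`E^{d_K}[p] ≅ E[p] ⊗ χ`), `ord_p ∏c_ℓ(Wd) = ord_p ∏c_ℓ(W)`
  (`c_ℓ` equal at `ℓ ∣ N`, `≤ 4` at the additive `ℓ ∣ d_K`; Jetchev–Skinner–Wan 2017 (eq:tamK)) and
  `ord_p u(Cd) = 0` (items (b), (d), (e)); items (a) multiplicative reduction at `p` and (c) the
  (ram) prime are DERIVED (`TwistTransport.lean`, `TwistTransportRam.lean`), and the model itself is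
  the tree's `hasGlobalMinimalModel_rat_holds` (Silverman AEC VIII.8 Cor. 8.3).
So, on its locus, class X11b hinges on STEP L plus tree plumbing ((b), (d), (e), (f)); nothing else unpublished.

References: [JetchevSkinnerWan2017] §7.4; [Skinner2016PacificMC] Thm. C; [KolyvaginEulerSystems1990]
Thm. A; [FriedbergHoffstein1995]; [Miller2011LMS] Def. 1.1.
-/

noncomputable section

open scoped Classical

open WeierstrassCurve NumberField Literature.NumberTheory.EllipticCurves
  Literature.NumberTheory.EllipticCurves.ModularForms
  Literature.NumberTheory.EllipticCurves.Rank1Residual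

namespace Summit.BirchSwinnertonDyer.Rank1Residual.X11b

/-- **The sub-cell target from STEP L and two transport packages.** Granted the PUBLISHED facts
(binders `hGZ`, `hKo`, `hB`, `hSk`, `hGZK`, `hmod`, `hnf`, `hFH`) and the two transport packages
(`hMan`: a Heegner point of a datum with Manin constant prime to `p`; `hTw`: every globally minimal
model of the twist `E^{d_K}` inherits irreducibility, the `p`-part of the Tamagawa product and a
`p`-unit scaling — see the module docstring for their printed sources; multiplicative reduction at
`p` and the (ram) prime are transported by `TwistTransport*.lean`), the typed input STEP L at every Heegner datum with Manin constant prime to `p` of every pair on the locus (`hL`; for a datum with `p ∣ c` the bound shifts by `2·ord_p c`, so the restriction is the correct reading of JSW/Castella, whose parametrisation is optimal with `c ∈ ℤ_(p)^×`) implies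
the sub-cell target (`X11b.Statement`): for every `(E,p)` in X11b with `p ≥ 5`, a (ram) prime and
`p ∤ ∏_ℓ c_ℓ(E)`, Miller's `BSD(E,p)`. Proof: `w(E) = (−1)^{r_an} = −1` (modularity); choose `K` by
Friedberg–Hoffstein with every `ℓ ∣ N` split, `|d_K| > 4` (so `w_K = 2`, prime to `p ≥ 5`) and
`L(E^{d_K},1) ≠ 0`; take the datum of `hMan` and a global minimal model of the twist (Néron); conclude by
`bsdp_of_classX11b_of_indexLowerBoundAt`. CONDITIONAL on STEP L; X11b stays CONSTRUCTION-SHAPED.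
[cite: JetchevSkinnerWan2017, §7.4.1 (choice of K′ by Friedberg–Hoffstein; pp. 30–31)]
[cite: Skinner2016PacificMC, Thm. C (§1)] [cite: Miller2011LMS, Def. 1.1] -/
theorem bsdp_of_classX11b_of_locus_of_transport
    -- published inputs (named facts of the tree)
    (hGZ : ∀ (N : ℕ) [NeZero N] (W : WeierstrassCurve ℚ) (K : Type) [Field K] [NumberField K],
      gross_zagier N W K)
    (hKo : ∀ (N : ℕ) [NeZero N] (W : WeierstrassCurve ℚ) (K : Type) [Field K] [NumberField K],
      kolyvagin N W K)
    (hB : ∀ (N : ℕ) [NeZero N] (W : WeierstrassCurve ℚ) (K : Type) [Field K] [NumberField K],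
      Kolyvagin1990_padicValNat_card_sha_le N W K)
    (hSk : Skinner2016.thmC_padicValRat_bsd_rank_zero)
    (hGZK : rank_eq_analyticRank_of_analyticRank_le_one) (hmod : hasEntireLFunction_rat)
    (hnf : exists_isNewformOf)
    (hFH : friedbergHoffstein_exists_heegnerField_split_twist_ne_zero)
    -- transport package 1: a Heegner point of a datum with Manin constant prime to `p`
    (hMan : ∀ (W : WeierstrassCurve ℚ) [W.IsElliptic] [W.IsGloballyMinimal] (p : ℕ) [Fact p.Prime]
      (N : ℕ) [NeZero N] (K : Type) [Field K] [NumberField K],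
      W.conductorNorm ℤ = N → 5 ≤ p → W.HasMultiplicativeReductionAtPrime p →
      W.HasIrreducibleModPGaloisRep p → IsImaginaryQuadratic K → SatisfiesHeegnerHypothesis N K →
      ∃ (Dt : ModularParametrizationData W N) (H : HeegnerDatum N (NumberField.discr K))
        (ι : K →+* ℂ) (P : (W.baseChange K).toAffine.Point),
        WeierstrassCurve.Affine.Point.map ι.toRatAlgHom P = heegnerPointComplex Dt H ∧
          ¬ (p : ℤ) ∣ Dt.c)
    -- transport package 2: every globally minimal model of the twist inherits irreducibility and
    -- the two decidable side conditions (items (b), (d), (e); (a) and (c) are `TwistTransport*.lean`)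
    (hTw : ∀ (W : WeierstrassCurve ℚ) [W.IsElliptic] [W.IsGloballyMinimal] (p : ℕ) [Fact p.Prime]
      (K : Type) [Field K] [NumberField K] (Wd : WeierstrassCurve ℚ) [Wd.IsElliptic]
      [Wd.IsGloballyMinimal] (Cd : VariableChange ℚ),
      5 ≤ p → IsImaginaryQuadratic K → SatisfiesHeegnerHypothesis (W.conductorNorm ℤ) K →
      W.HasMultiplicativeReductionAtPrime p → W.HasIrreducibleModPGaloisRep p →
      Cd • W.quadraticTwist (NumberField.discr K : ℚ) = Wd →
      Wd.HasIrreducibleModPGaloisRep p ∧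
        padicValNat p Wd.tamagawaProduct = padicValNat p W.tamagawaProduct ∧
        padicValRat p (Cd.u : ℚ) = 0)
    -- the typed input of the route (STEP L), at every Heegner datum of every pair on the locus
    (hL : ∀ (W : WeierstrassCurve ℚ) [W.IsElliptic] [W.IsGloballyMinimal] (p : ℕ) [Fact p.Prime]
      (N : ℕ) [NeZero N] (K : Type) [Field K] [NumberField K]
      (Dt : ModularParametrizationData W N) (H : HeegnerDatum N (NumberField.discr K)) (ι : K →+* ℂ)
      (P : (W.baseChange K).toAffine.Point),
      ClassX11b W p → Locus W p → W.conductorNorm ℤ = N → IsImaginaryQuadratic K →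
      SatisfiesHeegnerHypothesis N K →
      WeierstrassCurve.Affine.Point.map ι.toRatAlgHom P = heegnerPointComplex Dt H →
      ¬ (p : ℤ) ∣ Dt.c → IndexLowerBoundAt W p K P) :
    ∀ (W : WeierstrassCurve ℚ) [W.IsElliptic] [W.IsGloballyMinimal] (p : ℕ) [Fact p.Prime],
      ClassX11b W p → Locus W p → BSDp W p := by
  intro W _ _ p _ hX hloc
  have hp : p.Prime := Fact.out
  have hr : W.analyticRank = 1 := hX.1
  have hmult : Mult W p := hX.2.2.1
  have hirr : Irr W p := hX.2.2.2
  have hp5 : 5 ≤ p := hloc.1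
  have hram : Ram W p := hloc.2.1
  haveI : NeZero (W.conductorNorm ℤ) := ⟨(W.conductorNorm_pos_holds).ne'⟩
  -- the sign of the functional equation is `−1` (modularity, `r_an = 1`)
  have hw : W.rootNumber = -1 := by
    rw [WeierstrassCurve.rootNumber_eq_neg_one_pow_analyticRank_of_exists_isNewformOf hnf W, hr]
    norm_num
  -- the auxiliary field (Friedberg–Hoffstein): every `ℓ ∣ N` split, `|d_K| > 4`, `L(E^{d_K},1) ≠ 0`
  obtain ⟨K, _, _, hK, hdisc, hHN, -, hLt⟩ := hFH W hw p hp 4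
  -- `w_K = 2`, prime to `p ≥ 5`
  have hμ : ¬ p ∣ Units.torsionOrder K := by
    haveI : IsTotallyComplex K := hK.2
    have hneg : NumberField.discr K < 0 := discr_neg_of_finrank_eq_two K hK.1
    have habs : ((NumberField.discr K).natAbs : ℤ) = -NumberField.discr K :=
      Int.ofNat_natAbs_of_nonpos hneg.le
    have h4 : NumberField.discr K < -4 := by
      have : (4 : ℤ) < ((NumberField.discr K).natAbs : ℤ) := by exact_mod_cast hdisc
      omega
    rw [Literature.NumberTheory.DiophantineGeometry.torsionOrder_eq_two_of_discr_lt hK.1 h4]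
    intro h2
    have := Nat.le_of_dvd two_pos h2
    omega
  -- the Heegner datum with `p ∤ c` and the twist model
  obtain ⟨Dt, H, ι, P, hP, hc⟩ := hMan W p (W.conductorNorm ℤ) K rfl hp5 hmult hirr hK hHN
  -- a globally minimal model of the twist (Néron; Silverman VIII.8 Cor. 8.3)
  have hD0 : (NumberField.discr K : ℚ) ≠ 0 := by exact_mod_cast NumberField.discr_ne_zero K
  haveI hEt : (W.quadraticTwist (NumberField.discr K : ℚ)).IsElliptic :=
    W.isElliptic_quadraticTwist hD0
  obtain ⟨Cd, hCd⟩ := hasGlobalMinimalModel_rat_holds (W.quadraticTwist (NumberField.discr K : ℚ))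
  haveI : (Cd • W.quadraticTwist (NumberField.discr K : ℚ)).IsGloballyMinimal := hCd
  have hWd : Cd • W.quadraticTwist (NumberField.discr K : ℚ) =
      Cd • W.quadraticTwist (NumberField.discr K : ℚ) := rfl
  obtain ⟨hirrd, htam, hu⟩ :=
    hTw W p K (Cd • W.quadraticTwist (NumberField.discr K : ℚ)) Cd hp5 hK hHN hmult hirr hWd
  -- transports (a) and (c): the twist model is multiplicative at `p` and keeps the (ram) prime
  have hmultd : (Cd • W.quadraticTwist (NumberField.discr K : ℚ)).HasMultiplicativeReductionAtPrime p :=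
    hasMultiplicativeReductionAtPrime_twist_of_heegner' W p K hK hHN hmult Cd hWd
  have hramd : Ram (Cd • W.quadraticTwist (NumberField.discr K : ℚ)) p :=
    ram_twist_of_heegner W p K hK hHN hram Cd hWd
  exact bsdp_of_classX11b_of_indexLowerBoundAt W p (W.conductorNorm ℤ) K Dt H ι P
    (hGZ _ W K) (hKo _ W K) (hB _ W K) hSk hGZK hmod hX hloc hK hHN hP hc hμ hLt
    (Cd • W.quadraticTwist (NumberField.discr K : ℚ)) Cd hWd hmultd hirrd hramd htam hu
    (hL W p _ K Dt H ι P hX hloc rfl hK hHN hP hc)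

/-! ### The sub-cell target with transports (a), (c), (e) discharged (appended) -/

/-- **The sub-cell target from STEP L, the Manin-unit datum and TWO remaining transports
((b) irreducibility of the twist's `p`-torsion, (d) the `p`-part of its Tamagawa product).** Same as
`bsdp_of_classX11b_of_locus_of_transport`, with the side condition `ord_p u(Cd) = 0` now DERIVED
(`TwistTransportUnit.padicValRat_u_eq_zero_of_twist_minimal`: the minimal model of `E^{d_K}`
differs from `W^{(d_K)}` by a `p`-unit, since `p ∣ N` splits in `K`), in addition to multiplicative
reduction at `p` and the (ram) prime (`TwistTransport*.lean`). What the binder `hTw` still asks,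
for every globally minimal model `Wd = Cd • W^{(d_K)}`: `Wd[p]` irreducible (`E^{d_K}[p] ≅ E[p] ⊗ χ`,
Silverman X.5) and `ord_p ∏_ℓ c_ℓ(Wd) = ord_p ∏_ℓ c_ℓ(W)` (Jetchev–Skinner–Wan 2017 §7.3.1
(eq:tamK): equal at the split `ℓ ∣ N`, `≤ 4 < p` at `ℓ ∣ d_K`). CONDITIONAL on STEP L; X11b's
label unchanged. [cite: JetchevSkinnerWan2017, §7.3.1 (eq:tamK) and §7.4.1 (pp. 29–31)]
[cite: Skinner2016PacificMC, Thm. C (§1)] [cite: Miller2011LMS, Def. 1.1] -/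
theorem bsdp_of_classX11b_of_locus_of_transport'
    -- published inputs (named facts of the tree)
    (hGZ : ∀ (N : ℕ) [NeZero N] (W : WeierstrassCurve ℚ) (K : Type) [Field K] [NumberField K],
      gross_zagier N W K)
    (hKo : ∀ (N : ℕ) [NeZero N] (W : WeierstrassCurve ℚ) (K : Type) [Field K] [NumberField K],
      kolyvagin N W K)
    (hB : ∀ (N : ℕ) [NeZero N] (W : WeierstrassCurve ℚ) (K : Type) [Field K] [NumberField K],
      Kolyvagin1990_padicValNat_card_sha_le N W K)
    (hSk : Skinner2016.thmC_padicValRat_bsd_rank_zero)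
    (hGZK : rank_eq_analyticRank_of_analyticRank_le_one) (hmod : hasEntireLFunction_rat)
    (hnf : exists_isNewformOf)
    (hFH : friedbergHoffstein_exists_heegnerField_split_twist_ne_zero)
    -- transport package 1: a Heegner point of a datum with Manin constant prime to `p`
    (hMan : ∀ (W : WeierstrassCurve ℚ) [W.IsElliptic] [W.IsGloballyMinimal] (p : ℕ) [Fact p.Prime]
      (N : ℕ) [NeZero N] (K : Type) [Field K] [NumberField K],
      W.conductorNorm ℤ = N → 5 ≤ p → W.HasMultiplicativeReductionAtPrime p →
      W.HasIrreducibleModPGaloisRep p → IsImaginaryQuadratic K → SatisfiesHeegnerHypothesis N K →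
      ∃ (Dt : ModularParametrizationData W N) (H : HeegnerDatum N (NumberField.discr K))
        (ι : K →+* ℂ) (P : (W.baseChange K).toAffine.Point),
        WeierstrassCurve.Affine.Point.map ι.toRatAlgHom P = heegnerPointComplex Dt H ∧
          ¬ (p : ℤ) ∣ Dt.c)
    -- transport package 2 (remaining items (b), (d)): every globally minimal model of the twist has
    -- irreducible `p`-torsion and the same `p`-part of the Tamagawa product
    (hTw : ∀ (W : WeierstrassCurve ℚ) [W.IsElliptic] [W.IsGloballyMinimal] (p : ℕ) [Fact p.Prime]
      (K : Type) [Field K] [NumberField K] (Wd : WeierstrassCurve ℚ) [Wd.IsElliptic]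
      [Wd.IsGloballyMinimal] (Cd : VariableChange ℚ),
      5 ≤ p → IsImaginaryQuadratic K → SatisfiesHeegnerHypothesis (W.conductorNorm ℤ) K →
      W.HasMultiplicativeReductionAtPrime p → W.HasIrreducibleModPGaloisRep p →
      Cd • W.quadraticTwist (NumberField.discr K : ℚ) = Wd →
      Wd.HasIrreducibleModPGaloisRep p ∧
        padicValNat p Wd.tamagawaProduct = padicValNat p W.tamagawaProduct)
    -- the typed input of the route (STEP L), at every Heegner datum with Manin constant prime to `p`
    (hL : ∀ (W : WeierstrassCurve ℚ) [W.IsElliptic] [W.IsGloballyMinimal] (p : ℕ) [Fact p.Prime]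
      (N : ℕ) [NeZero N] (K : Type) [Field K] [NumberField K]
      (Dt : ModularParametrizationData W N) (H : HeegnerDatum N (NumberField.discr K)) (ι : K →+* ℂ)
      (P : (W.baseChange K).toAffine.Point),
      ClassX11b W p → Locus W p → W.conductorNorm ℤ = N → IsImaginaryQuadratic K →
      SatisfiesHeegnerHypothesis N K →
      WeierstrassCurve.Affine.Point.map ι.toRatAlgHom P = heegnerPointComplex Dt H →
      ¬ (p : ℤ) ∣ Dt.c → IndexLowerBoundAt W p K P) :
    ∀ (W : WeierstrassCurve ℚ) [W.IsElliptic] [W.IsGloballyMinimal] (p : ℕ) [Fact p.Prime],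
      ClassX11b W p → Locus W p → BSDp W p := by
  refine bsdp_of_classX11b_of_locus_of_transport hGZ hKo hB hSk hGZK hmod hnf hFH hMan ?_ hL
  intro W _ _ p _ K _ _ Wd _ _ Cd hp5 hK hH hmult hirr hWd
  obtain ⟨hirrd, htam⟩ := hTw W p K Wd Cd hp5 hK hH hmult hirr hWd
  exact ⟨hirrd, htam, padicValRat_u_eq_zero_of_twist_minimal W p K hK hH hmult Cd hWd⟩

end Summit.BirchSwinnertonDyer.Rank1Residual.X11b

end
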